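import Mathlib
import HarnessLib

/-!
# Contraction on a WEIGHTED BOX of an arbitrary product `ι → ℝ`: existence and uniqueness of the fixed
# point (the (k3) lemma of the Banach form of STAGE 3, `rung1/RUNG1-P2G7-REPORT.md` §27; cell
# harvest/h2-tao-ladder, seat p2; support for K1(1) = `NoSurvivingDSSOne`, stmt-NavierStokesRegularity-20205)

Generic real analysis; no lattice content and nothing about the Navier–Stokes equations.

SETTING. Coordinates `ι` (for STAGE 3: window ⊕ wake ⊕ top coordinates of a bi-infinite lattice state
together with the flight time), a centre `c`, box radii `R ≥ 0` and METRIC WEIGHTS `W > 0` with `R ≤ B·W`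
(the radii need not be the weights — this is the point of §27: the wake radii stay those of the self-map
while the metric weights grow geometrically), a map `T` of the box into itself which contracts the
box-normalised distance: whenever `|x - y| ≤ D·W` coordinatewise on the box, `|T x - T y| ≤ q·D·W` with a
uniform `q < 1`. CONCLUSION (`exists_unique_fixedPoint_of_weightedBox`): `T` has exactly one fixed point in
the box; it is the coordinatewise limit of the Picard iterates from the centre, with the geometric error
bound `|x⋆ - T^[n] c| ≤ 2B qⁿ/(1-q) · W` (`dist_iterate_fixedPoint_le`). No compactness, no Schauder, no
topology on `ι → ℝ` beyond coordinatewise convergence — the proof is Banach's, run coordinate by coordinate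
with the explicit geometric majorant (so neither a metric-space instance on the box nor `iSup`s are needed).
-/

noncomputable section

-- `Summit.NavierStokesRegularity.NavierStokesRegularity.…` is the tree's (summit = problem) namespace; the
-- duplicated component is intended, so the dupNamespace linter is silenced for this file.
set_option linter.dupNamespace false

namespace Summit.NavierStokesRegularity.NavierStokesRegularity.Theorems

namespace DSSOneShift

open Filter Topology

variable {ι : Type*}

section Iterates

variable {c R W : ι → ℝ} {B q : ℝ} {T : (ι → ℝ) → (ι → ℝ)} {xs : ℕ → ι → ℝ}

/-- Picard iterates stay in the box. [folklore] -/
theorem picard_mem_weightedBox (hR : ∀ i, 0 ≤ R i)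
    (hmaps : ∀ x : ι → ℝ, (∀ i, |x i - c i| ≤ R i) → ∀ i, |T x i - c i| ≤ R i)
    (hx0 : xs 0 = c) (hxs : ∀ n, xs (n + 1) = T (xs n)) (n : ℕ) : ∀ i, |xs n i - c i| ≤ R i := by
  induction n with
  | zero => intro i; rw [hx0]; simpa using hR i
  | succ n ih => intro i; rw [hxs]; exact hmaps _ ih i

/-- Consecutive Picard iterates are geometrically close in every coordinate: `|x_{n+1} - x_n| ≤ 2B qⁿ W`.
[folklore] -/
theorem dist_picard_succ_le (hR : ∀ i, 0 ≤ R i) (hB : ∀ i, R i ≤ B * W i) (hB0 : 0 ≤ B) (hq0 : 0 ≤ q)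
    (hmaps : ∀ x : ι → ℝ, (∀ i, |x i - c i| ≤ R i) → ∀ i, |T x i - c i| ≤ R i)
    (hlip : ∀ x y : ι → ℝ, (∀ i, |x i - c i| ≤ R i) → (∀ i, |y i - c i| ≤ R i) → ∀ D : ℝ, 0 ≤ D →
      (∀ i, |x i - y i| ≤ D * W i) → ∀ i, |T x i - T y i| ≤ q * D * W i)
    (hx0 : xs 0 = c) (hxs : ∀ n, xs (n + 1) = T (xs n)) (n : ℕ) :
    ∀ i, |xs (n + 1) i - xs n i| ≤ 2 * B * q ^ n * W i := by
  induction n with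
  | zero =>
    intro i
    have h1 := picard_mem_weightedBox hR hmaps hx0 hxs 1 i
    rw [hx0, pow_zero, mul_one]
    have h0 : 0 ≤ B * W i := (hR i).trans (hB i)
    linarith [hB i]
  | succ n ih =>
    intro i
    have hD : 0 ≤ 2 * B * q ^ n := by positivity
    have h := hlip (xs (n + 1)) (xs n) (picard_mem_weightedBox hR hmaps hx0 hxs (n + 1))
      (picard_mem_weightedBox hR hmaps hx0 hxs n) (2 * B * q ^ n) hD ih i
    rw [← hxs n] at h
    rw [hxs (n + 1)]
    calc |T (xs (n + 1)) i - xs (n + 1) i| ≤ q * (2 * B * q ^ n) * W i := h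
      _ = 2 * B * q ^ (n + 1) * W i := by ring

/-- Each coordinate of the Picard sequence converges, with the geometric error bound
`|x_n - x⋆| ≤ 2B qⁿ/(1-q) · W`. [folklore] -/
theorem tendsto_picard (hR : ∀ i, 0 ≤ R i) (hB : ∀ i, R i ≤ B * W i) (hB0 : 0 ≤ B) (hq0 : 0 ≤ q)
    (hq1 : q < 1)
    (hmaps : ∀ x : ι → ℝ, (∀ i, |x i - c i| ≤ R i) → ∀ i, |T x i - c i| ≤ R i)
    (hlip : ∀ x y : ι → ℝ, (∀ i, |x i - c i| ≤ R i) → (∀ i, |y i - c i| ≤ R i) → ∀ D : ℝ, 0 ≤ D →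
      (∀ i, |x i - y i| ≤ D * W i) → ∀ i, |T x i - T y i| ≤ q * D * W i)
    (hx0 : xs 0 = c) (hxs : ∀ n, xs (n + 1) = T (xs n)) (i : ι) :
    Tendsto (fun n => xs n i) atTop (𝓝 (limUnder atTop fun n => xs n i)) ∧
      ∀ n, |xs n i - limUnder atTop (fun n => xs n i)| ≤ 2 * B * W i * q ^ n / (1 - q) := by
  have hgeo : ∀ n, dist (xs n i) (xs (n + 1) i) ≤ 2 * B * W i * q ^ n := by
    intro n
    rw [dist_comm, Real.dist_eq]
    have := dist_picard_succ_le hR hB hB0 hq0 hmaps hlip hx0 hxs n i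
    nlinarith
  have hcauchy : CauchySeq fun n => xs n i := cauchySeq_of_le_geometric q (2 * B * W i) hq1 hgeo
  have hlim := hcauchy.tendsto_limUnder
  refine ⟨hlim, fun n => ?_⟩
  rw [← Real.dist_eq]
  exact dist_le_of_le_geometric_of_tendsto q (2 * B * W i) hq1 hgeo hlim n

end Iterates

/-- **Banach's fixed point theorem on a weighted box of `ι → ℝ`, coordinatewise form.**  Let `R ≥ 0`,
`R ≤ B·W` with `B ≥ 0` (so the intended weights `W` are positive wherever `R > 0`; positivity itself is
not needed), `0 ≤ q < 1`; let `T` map the box `{x | ∀ i, |x i - c i| ≤ R i}` into itself and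
contract box-normalised distances on it (`|x - y| ≤ D·W ⟹ |T x - T y| ≤ q·D·W`, coordinatewise). Then `T`
has a UNIQUE fixed point in the box. [folklore (Banach 1922 / Picard iteration; weighted sup-metric form)] -/
theorem exists_unique_fixedPoint_of_weightedBox (c R W : ι → ℝ) {B q : ℝ} (hR : ∀ i, 0 ≤ R i)
    (hB : ∀ i, R i ≤ B * W i) (hB0 : 0 ≤ B) (hq0 : 0 ≤ q) (hq1 : q < 1)
    (T : (ι → ℝ) → (ι → ℝ))
    (hmaps : ∀ x : ι → ℝ, (∀ i, |x i - c i| ≤ R i) → ∀ i, |T x i - c i| ≤ R i)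
    (hlip : ∀ x y : ι → ℝ, (∀ i, |x i - c i| ≤ R i) → (∀ i, |y i - c i| ≤ R i) → ∀ D : ℝ, 0 ≤ D →
      (∀ i, |x i - y i| ≤ D * W i) → ∀ i, |T x i - T y i| ≤ q * D * W i) :
    ∃ x : ι → ℝ, (∀ i, |x i - c i| ≤ R i) ∧ T x = x ∧
      ∀ y : ι → ℝ, (∀ i, |y i - c i| ≤ R i) → T y = y → y = x := by
  -- the Picard sequence from the centre and its coordinatewise limit
  set xs : ℕ → ι → ℝ := fun n => T^[n] c with hxs_def
  have hx0 : xs 0 = c := by simp [hxs_def]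
  have hxs : ∀ n, xs (n + 1) = T (xs n) := fun n => by
    simp only [hxs_def]; exact Function.iterate_succ_apply' T n c
  set x : ι → ℝ := fun i => limUnder atTop fun n => xs n i with hx_def
  have hmem := picard_mem_weightedBox hR hmaps hx0 hxs
  have hconv : ∀ i, Tendsto (fun n => xs n i) atTop (𝓝 (x i)) ∧
      ∀ n, |xs n i - x i| ≤ 2 * B * W i * q ^ n / (1 - q) := fun i =>
    tendsto_picard hR hB hB0 hq0 hq1 hmaps hlip hx0 hxs i
  have hq1' : 0 < 1 - q := by linarith
  have hpow : Tendsto (fun n : ℕ => q ^ n) atTop (𝓝 0) := tendsto_pow_atTop_nhds_zero_of_lt_one hq0 hq1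
  -- the limit lies in the (closed) box
  have hxbox : ∀ i, |x i - c i| ≤ R i := by
    intro i
    have hclosed : IsClosed {v : ℝ | |v - c i| ≤ R i} := by
      have : {v : ℝ | |v - c i| ≤ R i} = Metric.closedBall (c i) (R i) := by
        ext v; simp [Metric.mem_closedBall, Real.dist_eq]
      rw [this]; exact Metric.isClosed_closedBall
    exact hclosed.mem_of_tendsto (hconv i).1 (Eventually.of_forall fun n => hmem n i)
  -- `T x = x`: `|T x - x| ≤ q·D_n·W + |x_{n+1} - x|` with `D_n = 2B qⁿ/(1-q) → 0`
  have hfix : T x = x := by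
    funext i
    have hbound : ∀ n, |T x i - x i| ≤ (2 * B * W i / (1 - q)) * (q * q ^ n + q ^ (n + 1)) := by
      intro n
      have hD : 0 ≤ 2 * B * q ^ n / (1 - q) := by positivity
      have h1 : ∀ j, |x j - xs n j| ≤ 2 * B * q ^ n / (1 - q) * W j := by
        intro j
        rw [abs_sub_comm]
        have := (hconv j).2 n
        calc |xs n j - x j| ≤ 2 * B * W j * q ^ n / (1 - q) := this
          _ = 2 * B * q ^ n / (1 - q) * W j := by ring
      have h2 := hlip x (xs n) hxbox (hmem n) _ hD h1 i
      have h3 := (hconv i).2 (n + 1)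
      rw [hxs n] at h3
      calc |T x i - x i| ≤ |T x i - T (xs n) i| + |T (xs n) i - x i| := abs_sub_le _ _ _
        _ ≤ q * (2 * B * q ^ n / (1 - q)) * W i + 2 * B * W i * q ^ (n + 1) / (1 - q) := by
            linarith
        _ = (2 * B * W i / (1 - q)) * (q * q ^ n + q ^ (n + 1)) := by
            field_simp
    have htend : Tendsto (fun n : ℕ => (2 * B * W i / (1 - q)) * (q * q ^ n + q ^ (n + 1))) atTop
        (𝓝 0) := by
      have h1 : Tendsto (fun n : ℕ => q * q ^ n + q ^ (n + 1)) atTop (𝓝 (q * 0 + 0)) := by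
        refine (hpow.const_mul q).add ?_
        simpa [pow_succ] using hpow.mul_const q
      simpa using h1.const_mul (2 * B * W i / (1 - q))
    have hle : |T x i - x i| ≤ 0 := ge_of_tendsto' htend hbound
    have : |T x i - x i| = 0 := le_antisymm hle (abs_nonneg _)
    exact sub_eq_zero.1 (abs_eq_zero.1 this)
  refine ⟨x, hxbox, hfix, fun y hybox hyfix => ?_⟩
  -- uniqueness: `|y - x| ≤ 2B qⁿ W` for every `n`
  have hind : ∀ n : ℕ, ∀ i, |y i - x i| ≤ 2 * B * q ^ n * W i := by
    intro n
    induction n with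
    | zero =>
      intro i
      have h1 := hybox i
      have h2 := hxbox i
      have h3 : |y i - x i| ≤ |y i - c i| + |x i - c i| := by
        rw [← abs_sub_comm (c i) (x i)]; exact abs_sub_le _ _ _
      have h0 : R i ≤ B * W i := hB i
      rw [pow_zero, mul_one]
      linarith
    | succ n ih =>
      intro i
      have hD : 0 ≤ 2 * B * q ^ n := by positivity
      have h := hlip y x hybox hxbox _ hD ih i
      rw [hyfix, hfix] at h
      calc |y i - x i| ≤ q * (2 * B * q ^ n) * W i := h
        _ = 2 * B * q ^ (n + 1) * W i := by ring
  funext i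
  have htend : Tendsto (fun n : ℕ => 2 * B * q ^ n * W i) atTop (𝓝 0) := by
    simpa [mul_comm, mul_left_comm, mul_assoc] using (hpow.const_mul (2 * B * W i))
  have hle : |y i - x i| ≤ 0 := ge_of_tendsto' htend fun n => hind n i
  have : |y i - x i| = 0 := le_antisymm hle (abs_nonneg _)
  exact sub_eq_zero.1 (abs_eq_zero.1 this)

end DSSOneShift

end Summit.NavierStokesRegularity.NavierStokesRegularity.Theorems
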